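import Summits.HubbardSuperconductivity.HubbardSuperconductivity.Theorems.AposterioriCapRgSsbToEvenTorusLroPairTransferRung
import Literature.MathematicalPhysics.QuantumLattice.FinDimSpectrumSectorGibbsLimit
import Literature.MathematicalPhysics.QuantumLattice.FinDimSpectrumClusterGapProofs
import Literature.MathematicalPhysics.QuantumLattice.FreeFermiGasNoPairFieldLRO
import Literature.MathematicalPhysics.QuantumLattice.SectorEigenvalueContinuation

/-!
# Route `JosephsonMirror` — the bridge engine with APPROXIMATE low-lying orthogonality

Helper file for the crux stmt-HubbardSuperconductivity-2227 (`JmInterchange`) of route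
`JosephsonMirror` (sub-problem `HubbardSuperconductivity`), line `Sketch`, stub
`stub_bridgeFromFloorOrderApprox`: the theorem `bridgeFromFloorOrderApprox` is the def body of the
skeleton's `BridgeFromFloorOrderApprox` with `ApproxLowLyingOrthogonality`, `ChargingFloor`,
`FloorOrder`, `FloorBridge` and `statN` unfolded.

Setting: `H = hubbardTorus 2 L 1 U`, `Δ = pairField dWaveFormFactor L`, `N_L = 2⌊(1-δ)L²/2⌋`,
`e(k) = minEnergyOn H (szSector k 0)`, a scale `γ_L` with `γ_L L² → ∞`, and the spectral
projection `Q = U · diag 𝟙[e < λᵢ < e + γ_L] · U⋆` (`e = e(N_L - 2)`, `U = hH.eigenvectorUnitary`)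
onto the open window above the floor of the sector `K = szSector (N_L - 2) 0`. Hypotheses:
(i) `‖Q Δg‖² ≤ ‖Δg‖²/4` for every ground state `g` of `(N_L, 0)`; (ii)
`2e(N_L) - e(N_L+2) - e(N_L-2) ≤ ε γ_L` eventually, for every `ε > 0`; (iii) eventually some unit
ground state `g` of `(N_L, 0)` has `‖Δ g‖² ≥ cL⁴`. Conclusion (`FloorBridge`): eventually a unit
ground state `χ` of `(N_L - 2, 0)` has `|⟨χ, Δ g⟩|² ≥ (c/4) L⁴`.

Proof: as the exact engine `Theorems/JosephsonMirrorJmInterchangeBridge` (rung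
`Theorems.stub_pairTransferRung` at `m = N_L - 2`, (ii) at `ε = 1/4`), with the spectral Markov
step carrying the window weight `‖Qu‖² ≤ ‖u‖²/4` (`spectralMarkov_of_window_weight`): the
capture becomes `γ_L ((3/4)‖u‖² - ‖u₀‖²) ≤ exc ≤ CL² + (γ_L/4)‖u‖²`, whence `a' = c/4`.

Sources: T. Koma, H. Tasaki, J. Stat. Phys. 76 (1994) 745; H. Tasaki, *Physics and Mathematics of
Quantum Many-Body Systems* (2020) §2.1, App. A.2; C. Eckart, Phys. Rev. 36 (1930) 878. All linear
algebra is folklore. No new definitions.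
-/

-- the mandated namespace `Summit.<Summit>.<Problem>.Theorems` repeats `HubbardSuperconductivity`
-- (single-problem summit, D-0017), which the `dupNamespace` linter flags on every declaration
set_option linter.dupNamespace false

namespace Summit.HubbardSuperconductivity.HubbardSuperconductivity.Theorems.JosephsonMirror

open Matrix Literature.MathematicalPhysics.QuantumLattice Filter
open Literature.MathematicalPhysics.QuantumLattice.EigenvalueContinuation
open scoped ComplexOrder InnerProductSpace

/-! ## §1 Spectral Markov with a window weight, on an invariant sector -/

section Spectral

variable {n : Type*} [Fintype n] [DecidableEq n]

/-- **Weight of a vector on a set of eigenvectors.** For a Hermitian `H` with eigenbasis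
`U = hH.eigenvectorUnitary` (columns `bᵢ`) and a set of indices `p`, the spectral projection
`Q = U · diag 𝟙[p] · U⋆` has `‖Q x‖² = Σ_{p i} |⟨bᵢ, x⟩|²` (`U⋆U = 1` and `(U⋆x)ᵢ = ⟨bᵢ, x⟩`).
Tasaki (2020) App. A.2. [folklore] -/
theorem re_norm_sq_spectralIndicator_mulVec {H : Matrix n n ℂ} (hH : H.IsHermitian)
    (p : n → Prop) [DecidablePred p] (x : n → ℂ) :
    (star (((hH.eigenvectorUnitary : Matrix n n ℂ) * diagonal (fun i => if p i then (1 : ℂ) else 0)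
        * star (hH.eigenvectorUnitary : Matrix n n ℂ)) *ᵥ x) ⬝ᵥ
      (((hH.eigenvectorUnitary : Matrix n n ℂ) * diagonal (fun i => if p i then (1 : ℂ) else 0)
        * star (hH.eigenvectorUnitary : Matrix n n ℂ)) *ᵥ x)).re =
      ∑ i, if p i then ‖⟪hH.eigenvectorBasis i, (WithLp.toLp 2 x : EuclideanSpace ℂ n)⟫_ℂ‖ ^ 2
        else 0 := by
  set U : Matrix n n ℂ := (hH.eigenvectorUnitary : Matrix n n ℂ) with hU
  have hUU : Uᴴ * U = 1 := Unitary.coe_star_mul_self hH.eigenvectorUnitary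
  -- the coefficients `(U⋆ x)ᵢ = ⟨bᵢ, x⟩`
  have hzi : ∀ i, (star U *ᵥ x) i =
      ⟪hH.eigenvectorBasis i, (WithLp.toLp 2 x : EuclideanSpace ℂ n)⟫_ℂ := fun i => by
    rw [EuclideanSpace.inner_eq_star_dotProduct, dotProduct_comm]
    simp only [mulVec, dotProduct, star_apply, hU, IsHermitian.eigenvectorUnitary_apply,
      Pi.star_apply]
  have hDz : diagonal (fun i => if p i then (1 : ℂ) else 0) *ᵥ (star U *ᵥ x) =
      fun i => if p i then (star U *ᵥ x) i else 0 :=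
    funext fun i => by rw [mulVec_diagonal, ite_mul, one_mul, zero_mul]
  rw [← mulVec_mulVec, ← mulVec_mulVec,
    Literature.MathematicalPhysics.QuantumLattice.star_mulVec_dotProduct_mulVec, hUU, one_mulVec,
    hDz, re_star_dotProduct_self]
  refine Finset.sum_congr rfl fun i _ => ?_
  dsimp only
  split_ifs <;> simp [hzi]

/-- **Rayleigh lower bound with a window.** `H` Hermitian with eigenbasis `bᵢ`, `K` an
`H`-invariant subspace, `r ∈ K` orthogonal to every eigenvector `w ∈ K` of `H` with eigenvalue
`≤ t`; then `(t + γ) ‖r‖² - γ Σ_{t < λᵢ < t + γ} |⟨bᵢ, r⟩|² ≤ Re⟨r, H r⟩` (the coefficients with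
`λᵢ ≤ t` vanish: `⟨bᵢ, r⟩ = ⟨P_K bᵢ, r⟩` and `P_K bᵢ ∈ K` is a `λᵢ`-eigenvector since `P_K`
commutes with `H`; then compare `Σ λᵢ |⟨bᵢ, r⟩|²` and `Σ |⟨bᵢ, r⟩|²` termwise).
Tasaki (2020) App. A.2. [folklore] -/
theorem window_rayleigh_lower {H : Matrix n n ℂ} (hH : H.IsHermitian)
    (K : Submodule ℂ (n → ℂ)) (hinv : ∀ v ∈ K, H *ᵥ v ∈ K) {r : n → ℂ} (hr : r ∈ K) (t γ : ℝ)
    (horth : ∀ w ∈ K, ∀ μ : ℝ, H *ᵥ w = (μ : ℂ) • w → μ ≤ t → star w ⬝ᵥ r = 0) :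
    (t + γ) * (star r ⬝ᵥ r).re -
        γ * ∑ i, (if t < hH.eigenvalues i ∧ hH.eigenvalues i < t + γ then
          ‖⟪hH.eigenvectorBasis i, (WithLp.toLp 2 r : EuclideanSpace ℂ n)⟫_ℂ‖ ^ 2 else 0) ≤
      (star r ⬝ᵥ H *ᵥ r).re := by
  set P := projMatrix (K.map ((WithLp.linearEquiv 2 ℂ (n → ℂ)).symm :
    (n → ℂ) →ₗ[ℂ] EuclideanSpace ℂ n)) with hP
  have hcol : ∀ j, H *ᵥ ⇑(hH.eigenvectorBasis j) =
      ((hH.eigenvalues j : ℝ) : ℂ) • ⇑(hH.eigenvectorBasis j) := fun j => by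
    rw [hH.mulVec_eigenvectorBasis j, RCLike.real_smul_eq_coe_smul (K := ℂ)]
    rfl
  -- the coefficients of `r` along eigenvectors at or below `t` vanish
  have hcoef : ∀ j, hH.eigenvalues j ≤ t →
      ⟪hH.eigenvectorBasis j, (WithLp.toLp 2 r : EuclideanSpace ℂ n)⟫_ℂ = 0 := fun j hj => by
    have hw : H *ᵥ (P *ᵥ ⇑(hH.eigenvectorBasis j)) =
        ((hH.eigenvalues j : ℝ) : ℂ) • (P *ᵥ ⇑(hH.eigenvectorBasis j)) := by
      rw [mulVec_mulVec, hP, ← projMatrix_map_commute_of_invariant hH K hinv, ← mulVec_mulVec,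
        hcol j, mulVec_smul]
    have h0 := horth _ (projMatrix_map_mulVec_mem K _) _ hw hj
    rw [star_mulVec, ← dotProduct_mulVec, (projMatrix_isHermitian _).eq,
      projMatrix_map_mulVec_of_mem K hr] at h0
    rw [EuclideanSpace.inner_eq_star_dotProduct, dotProduct_comm]
    exact h0
  have hquad : (star r ⬝ᵥ H *ᵥ r).re = ∑ i, hH.eigenvalues i *
      ‖⟪hH.eigenvectorBasis i, (WithLp.toLp 2 r : EuclideanSpace ℂ n)⟫_ℂ‖ ^ 2 := by
    rw [← re_inner_toEuclideanLin_eq_sum hH, RCLike.re_to_complex,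
      EuclideanSpace.inner_eq_star_dotProduct]
    exact congrArg Complex.re (dotProduct_comm _ _)
  have hnorm : (star r ⬝ᵥ r).re =
      ∑ i, ‖⟪hH.eigenvectorBasis i, (WithLp.toLp 2 r : EuclideanSpace ℂ n)⟫_ℂ‖ ^ 2 := by
    rw [Matrix.star_dotProduct_self_re, norm_sq_eq_sum_eigenvectorBasis hH]
  rw [hquad, hnorm, Finset.mul_sum, Finset.mul_sum, ← Finset.sum_sub_distrib]
  refine Finset.sum_le_sum fun i _ => ?_
  rcases le_or_gt (hH.eigenvalues i) t with hi | hi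
  · rw [hcoef i hi, norm_zero]; simp
  · have hc := sq_nonneg ‖⟪hH.eigenvectorBasis i, (WithLp.toLp 2 r : EuclideanSpace ℂ n)⟫_ℂ‖
    split_ifs with hw
    · linarith [mul_le_mul_of_nonneg_right hi.le hc]
    · have hge : t + γ ≤ hH.eigenvalues i := not_lt.1 fun hlt => hw ⟨hi, hlt⟩
      linarith [mul_le_mul_of_nonneg_right hge hc]

-- copied from JosephsonMirrorJmInterchangeBridge (`minEnergyOn_mul_le_of_mem`), difference form
/-- The sector variational principle without normalisation:
`0 ≤ Re⟨v, Hv⟩ - minEnergyOn H K · ‖v‖²` for every `v ∈ K` (`minEnergyOn_le_rayleigh_of_mem`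
after normalising; trivial at `v = 0`). Tasaki (2020) §2.1. [folklore] -/
theorem rayleigh_sub_minEnergyOn_mul_nonneg {H : Matrix n n ℂ} (hH : H.IsHermitian)
    (K : Submodule ℂ (n → ℂ)) {v : n → ℂ} (hv : v ∈ K) :
    0 ≤ (star v ⬝ᵥ H *ᵥ v).re - H.minEnergyOn K * (star v ⬝ᵥ v).re := by
  by_cases hv0 : v = 0
  · simp [hv0]
  obtain ⟨c, -, hcc, h1⟩ := exists_normalize hv0
  have hle := minEnergyOn_le_rayleigh_of_mem hH K (K.smul_mem (c : ℂ) hv) h1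
  rw [mulVec_smul, star_real_smul_dotProduct_real_smul, Complex.re_ofReal_mul] at hle
  have h := mul_le_mul_of_nonneg_right hle (re_star_dotProduct_self_nonneg v)
  have h' : c * c * (star v ⬝ᵥ H *ᵥ v).re * (star v ⬝ᵥ v).re = (star v ⬝ᵥ H *ᵥ v).re := by
    rw [show c * c * (star v ⬝ᵥ H *ᵥ v).re * (star v ⬝ᵥ v).re =
      (star v ⬝ᵥ H *ᵥ v).re * (c * c * (star v ⬝ᵥ v).re) by ring, hcc, mul_one]
  linarith

/-- **Spectral Markov on an invariant sector, with a window weight.** `H` Hermitian with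
eigenbasis `U = hH.eigenvectorUnitary`, `K` an `H`-invariant subspace, `e = minEnergyOn H K`,
`u ∈ K`, `γ ≥ 0`, and `‖Q u‖² ≤ θ‖u‖²` for `Q = U · diag 𝟙[e < λᵢ < e + γ] · U⋆`. With
`u₀ = P_{E₀} u`, `E₀ = K ⊓ ker (H - e)`: `u₀ ∈ K`, `H u₀ = e u₀`, `⟨u₀, u⟩ = ‖u₀‖²`, and
`γ ((1 - θ)‖u‖² - ‖u₀‖²) ≤ Re⟨u, Hu⟩ - e‖u‖²` (`r = u - u₀ ∈ K` is orthogonal to the eigenvectors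
of `H|K` with eigenvalue `≤ e`, so `window_rayleigh_lower` applies; the window coefficients of `r`
and `u` agree since `u₀ ⊥ bᵢ` for `λᵢ ≠ e`, and sum to `‖Q u‖²`; `‖u‖² = ‖u₀‖² + ‖r‖²`,
`Re⟨u, Hu⟩ = e‖u₀‖² + Re⟨r, Hr⟩`). Tasaki (2020) §2.1, App. A.2; Eckart (1930). [folklore] -/
theorem spectralMarkov_of_window_weight {H : Matrix n n ℂ} (hH : H.IsHermitian)
    (K : Submodule ℂ (n → ℂ)) (hinv : ∀ v ∈ K, H *ᵥ v ∈ K) {u : n → ℂ} (hu : u ∈ K) (γ θ : ℝ)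
    (hγ : 0 ≤ γ)
    (hwin : (star (((hH.eigenvectorUnitary : Matrix n n ℂ) *
        diagonal (fun i => if H.minEnergyOn K < hH.eigenvalues i ∧
          hH.eigenvalues i < H.minEnergyOn K + γ then (1 : ℂ) else 0) *
            star (hH.eigenvectorUnitary : Matrix n n ℂ)) *ᵥ u) ⬝ᵥ
      (((hH.eigenvectorUnitary : Matrix n n ℂ) *
        diagonal (fun i => if H.minEnergyOn K < hH.eigenvalues i ∧
          hH.eigenvalues i < H.minEnergyOn K + γ then (1 : ℂ) else 0) *
            star (hH.eigenvectorUnitary : Matrix n n ℂ)) *ᵥ u)).re ≤ θ * (star u ⬝ᵥ u).re) :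
    ∃ u₀ : n → ℂ, u₀ ∈ K ∧ H *ᵥ u₀ = ((H.minEnergyOn K : ℝ) : ℂ) • u₀ ∧
      star u₀ ⬝ᵥ u = star u₀ ⬝ᵥ u₀ ∧
      γ * ((1 - θ) * (star u ⬝ᵥ u).re - (star u₀ ⬝ᵥ u₀).re) ≤
        (star u ⬝ᵥ H *ᵥ u).re - H.minEnergyOn K * (star u ⬝ᵥ u).re := by
  rw [re_norm_sq_spectralIndicator_mulVec hH] at hwin
  set e : ℝ := H.minEnergyOn K with he
  set E₀ : Submodule ℂ (n → ℂ) := K ⊓ Module.End.eigenspace (Matrix.toLin' H) ((e : ℝ) : ℂ)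
    with hE₀
  have hmemE₀ : ∀ w, w ∈ E₀ ↔ w ∈ K ∧ H *ᵥ w = ((e : ℝ) : ℂ) • w := fun w => by
    rw [hE₀, Submodule.mem_inf, Module.End.mem_eigenspace_iff, Matrix.toLin'_apply]
  set P₀ := projMatrix (E₀.map ((WithLp.linearEquiv 2 ℂ (n → ℂ)).symm :
    (n → ℂ) →ₗ[ℂ] EuclideanSpace ℂ n)) with hP₀
  have hP₀h : P₀.IsHermitian := projMatrix_isHermitian _
  set u₀ : n → ℂ := P₀ *ᵥ u with hu₀
  have hu₀E : u₀ ∈ E₀ := projMatrix_map_mulVec_mem E₀ u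
  obtain ⟨hu₀K, hHu₀⟩ := (hmemE₀ u₀).1 hu₀E
  -- `⟨χ, u₀⟩ = ⟨χ, u⟩` for `χ ∈ E₀`, i.e. `r = u - u₀ ⊥ E₀`
  have hproj : ∀ χ ∈ E₀, star χ ⬝ᵥ u₀ = star χ ⬝ᵥ u := fun χ hχ => by
    have hPχ : P₀ *ᵥ χ = χ := by rw [hP₀]; exact projMatrix_map_mulVec_of_mem E₀ hχ
    calc star χ ⬝ᵥ u₀ = star (P₀ *ᵥ χ) ⬝ᵥ u := by
          rw [hu₀, star_mulVec, ← dotProduct_mulVec, hP₀h.eq]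
      _ = star χ ⬝ᵥ u := by rw [hPχ]
  set r : n → ℂ := u - u₀ with hr
  have hrK : r ∈ K := K.sub_mem hu hu₀K
  have horthE₀ : ∀ χ ∈ E₀, star χ ⬝ᵥ r = 0 := fun χ hχ => by
    rw [hr, dotProduct_sub, hproj χ hχ, sub_self]
  -- `r` is orthogonal to every eigenvector of `H|K` at or below `e`
  have hlow : ∀ w ∈ K, ∀ μ : ℝ, H *ᵥ w = (μ : ℂ) • w → μ ≤ e → star w ⬝ᵥ r = 0 := by
    intro w hwK μ hHw hμ
    rcases hμ.lt_or_eq with hlt | heq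
    · have h0 : w = 0 := by -- below the sector floor: `w = 0`
        rw [← projMatrix_map_mulVec_of_mem K hwK]
        exact projMatrix_map_mulVec_eigenvector_below_eq_zero hH K hinv hHw hlt
      rw [h0, star_zero, zero_dotProduct]
    · refine horthE₀ w ((hmemE₀ w).2 ⟨hwK, ?_⟩) -- on the floor: `w ∈ E₀ ⊥ r`
      rw [← heq]; exact hHw
  have hgap := window_rayleigh_lower hH K hinv hrK e γ hlow
  -- the window coefficients of `r` are those of `u`
  have hcol : ∀ j, H *ᵥ ⇑(hH.eigenvectorBasis j) =
      ((hH.eigenvalues j : ℝ) : ℂ) • ⇑(hH.eigenvectorBasis j) := fun j => by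
    rw [hH.mulVec_eigenvectorBasis j, RCLike.real_smul_eq_coe_smul (K := ℂ)]
    rfl
  have hsum : ∑ i, (if e < hH.eigenvalues i ∧ hH.eigenvalues i < e + γ then
      ‖⟪hH.eigenvectorBasis i, (WithLp.toLp 2 r : EuclideanSpace ℂ n)⟫_ℂ‖ ^ 2 else 0) =
      ∑ i, (if e < hH.eigenvalues i ∧ hH.eigenvalues i < e + γ then
      ‖⟪hH.eigenvectorBasis i, (WithLp.toLp 2 u : EuclideanSpace ℂ n)⟫_ℂ‖ ^ 2 else 0) := by
    refine Finset.sum_congr rfl fun i _ => ?_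
    split_ifs with hw
    · have h0 : star ⇑(hH.eigenvectorBasis i) ⬝ᵥ u₀ = 0 :=
        star_dotProduct_eigenvectors_eq_zero_of_ne hH hHu₀ (hcol i) hw.1.ne'
      rw [EuclideanSpace.inner_eq_star_dotProduct, EuclideanSpace.inner_eq_star_dotProduct,
        dotProduct_comm, WithLp.ofLp_toLp, WithLp.ofLp_toLp, hr, dotProduct_sub, h0, sub_zero,
        dotProduct_comm]
    · rfl
  rw [hsum] at hgap
  -- Pythagoras and the energy split
  have hu₀r : star u₀ ⬝ᵥ r = 0 := horthE₀ u₀ hu₀E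
  have hru₀ : star r ⬝ᵥ u₀ = 0 := by rw [star_dotProduct, hu₀r, star_zero]
  have hur : u = u₀ + r := by rw [hr, add_sub_cancel]
  have hnorm : (star u ⬝ᵥ u).re = (star u₀ ⬝ᵥ u₀).re + (star r ⬝ᵥ r).re := by
    rw [hur, star_add, add_dotProduct, dotProduct_add, dotProduct_add, hu₀r, hru₀, add_zero,
      zero_add, Complex.add_re]
  have henergy : (star u ⬝ᵥ H *ᵥ u).re = e * (star u₀ ⬝ᵥ u₀).re + (star r ⬝ᵥ H *ᵥ r).re := by
    have h1 : star r ⬝ᵥ H *ᵥ u₀ = 0 := by rw [hHu₀, dotProduct_smul, hru₀, smul_zero]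
    have h2 : star u₀ ⬝ᵥ H *ᵥ r = 0 := by rw [star_dotProduct_mulVec_comm hH.eq, h1, star_zero]
    rw [hur, mulVec_add, star_add, add_dotProduct, dotProduct_add, dotProduct_add, h1, h2,
      add_zero, zero_add, Complex.add_re, re_star_dotProduct_mulVec_of_eigen hHu₀]
  have hθ := mul_le_mul_of_nonneg_left hwin hγ
  rw [hnorm] at hθ
  refine ⟨u₀, hu₀K, hHu₀, ?_, ?_⟩
  · rw [hur, dotProduct_add, hu₀r, add_zero]
  · rw [hnorm, henergy]
    linarith [hgap, hθ]

end Spectral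

/-! ## §2 The approximate bridge engine on the torus -/

/-- The real-arithmetic endgame of the approximate bridge: from the Markov capture
`γ ((1 - 1/4) S - X) ≤ A - e S`, the rung `(A - e S) + (A' - e' S') ≤ C L² + M S` with
`0 ≤ A' - e' S'` and `M S ≤ (γ/4) S`, the floor order `c L⁴ ≤ S` and the scale condition
`4 C ≤ γ L² c` (`γ > 0`): `(c/4) L⁴ ≤ X`. [folklore] -/
theorem bridge_real_endgame_approx {γ S X A e A' e' S' C M c L2 : ℝ} (hγ : 0 < γ) (hL2 : 0 ≤ L2)
    (hmk : γ * ((1 - 1 / 4) * S - X) ≤ A - e * S)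
    (h3 : A - e * S + (A' - e' * S') ≤ C * L2 + M * S) (hvar : 0 ≤ A' - e' * S')
    (hM : M * S ≤ γ / 4 * S) (hS : c * L2 ^ 2 ≤ S) (hG : 4 * C ≤ γ * L2 * c) :
    c / 4 * L2 ^ 2 ≤ X := by
  have h1 : γ * (c * L2 ^ 2) ≤ γ * S := mul_le_mul_of_nonneg_left hS hγ.le
  have h2 : C * L2 ≤ γ * L2 * c / 4 * L2 := mul_le_mul_of_nonneg_right (by linarith) hL2
  have h : γ * (c / 4 * L2 ^ 2) ≤ γ * X := by nlinarith [h1, h2, hmk, h3, hvar, hM]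
  exact le_of_mul_le_mul_left h hγ

/-- **The approximate bridge engine** (`BridgeFromFloorOrderApprox` of the skeleton of crux
`JmInterchange`, line `Sketch`, unfolded; notation of the module docstring): if (i) the spectral
weight of `Δ g` on the window `(e(N_L-2), e(N_L-2) + γ_L)` is at most `‖Δ g‖²/4` for every ground
state `g` of `(N_L, 0)`, (ii) `2e(N_L) - e(N_L+2) - e(N_L-2) ≤ ε γ_L` eventually for every `ε > 0`,
and (iii) eventually some unit ground state `g` of `(N_L, 0)` has `‖Δ g‖² ≥ cL⁴`, then eventually
there are unit ground states `φ` of `(N_L, 0)` and `χ` of `(N_L - 2, 0)` with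
`|⟨χ, Δ φ⟩|² ≥ (c/4)L⁴` (rung `Theorems.stub_pairTransferRung` + `spectralMarkov_of_window_weight`).
Koma–Tasaki, J. Stat. Phys. 76 (1994) 745. [folklore] -/
theorem bridgeFromFloorOrderApprox :
    ∀ (U δ : ℝ), 0 < U → δ ∈ Set.Ioo (0:ℝ) (1 / 2) → ∀ γ : ℕ → ℝ,
    Tendsto (fun L : ℕ => γ L * (L : ℝ) ^ 2) atTop atTop →
    (∃ L₀ : ℕ, ∀ (L : ℕ) [NeZero L], Even L → L₀ ≤ L →
      ∀ g : Fock (Orb (FermionTorus 2 L)),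
        IsGroundStateInSector (hubbardTorus 2 L 1 U) (2 * ⌊(1 - δ) * (L : ℝ) ^ 2 / 2⌋₊) 0 g →
        (let H : Matrix (Finset (Orb (FermionTorus 2 L))) (Finset (Orb (FermionTorus 2 L))) ℂ :=
           hubbardTorus 2 L 1 U
         let hH : H.IsHermitian := LiebThm1.hamiltonian_isHermitian (fermionTorusGraph 2 L) 1 U
         let e : ℝ := H.minEnergyOn (szSector (2 * ⌊(1 - δ) * (L : ℝ) ^ 2 / 2⌋₊ - 2) 0)
         let Q : Matrix (Finset (Orb (FermionTorus 2 L))) (Finset (Orb (FermionTorus 2 L))) ℂ :=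
           (hH.eigenvectorUnitary : Matrix _ _ ℂ) *
             Matrix.diagonal (fun i => if e < hH.eigenvalues i ∧ hH.eigenvalues i < e + γ L
               then (1 : ℂ) else 0) * star (hH.eigenvectorUnitary : Matrix _ _ ℂ)
         let u : Fock (Orb (FermionTorus 2 L)) := pairField dWaveFormFactor L *ᵥ g
         (star (Q *ᵥ u) ⬝ᵥ (Q *ᵥ u)).re ≤ (1 / 4) * (star u ⬝ᵥ u).re)) →
    (∀ ε : ℝ, 0 < ε → ∃ L₀ : ℕ, ∀ (L : ℕ), Even L → L₀ ≤ L →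
      (let e : ℕ → ℝ := fun n => (hubbardTorus 2 L 1 U).minEnergyOn (szSector n 0)
       let N : ℕ := 2 * ⌊(1 - δ) * (L : ℝ) ^ 2 / 2⌋₊
       2 * e N - e (N + 2) - e (N - 2) ≤ ε * γ L)) →
    (∃ c : ℝ, 0 < c ∧ ∃ L₀ : ℕ, ∀ (L : ℕ) [NeZero L], Even L → L₀ ≤ L →
      ∃ g : Fock (Orb (FermionTorus 2 L)),
        IsGroundStateInSector (hubbardTorus 2 L 1 U) (2 * ⌊(1 - δ) * (L : ℝ) ^ 2 / 2⌋₊) 0 g ∧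
        star g ⬝ᵥ g = 1 ∧
        c * (L : ℝ) ^ 4 ≤
          (star (pairField dWaveFormFactor L *ᵥ g) ⬝ᵥ (pairField dWaveFormFactor L *ᵥ g)).re) →
    ∃ a' : ℝ, 0 < a' ∧ ∃ L₀ : ℕ, ∀ (L : ℕ) [NeZero L], Even L → L₀ ≤ L → ∃ φ χ : Literature.MathematicalPhysics.QuantumLattice.Fock (Literature.MathematicalPhysics.QuantumLattice.Orb (Literature.MathematicalPhysics.QuantumLattice.FermionTorus 2 L)), Literature.MathematicalPhysics.QuantumLattice.IsGroundStateInSector (Literature.MathematicalPhysics.QuantumLattice.hubbardTorus 2 L 1 U) (2 * ⌊(1 - δ) * (L : ℝ) ^ 2 / 2⌋₊) 0 φ ∧ star φ ⬝ᵥ φ = 1 ∧ Literature.MathematicalPhysics.QuantumLattice.IsGroundStateInSector (Literature.MathematicalPhysics.QuantumLattice.hubbardTorus 2 L 1 U) (2 * ⌊(1 - δ) * (L : ℝ) ^ 2 / 2⌋₊ - 2) 0 χ ∧ star χ ⬝ᵥ χ = 1 ∧ a' * (L : ℝ) ^ 4 ≤ ‖star χ ⬝ᵥ Matrix.mulVec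 (Literature.MathematicalPhysics.QuantumLattice.pairField Literature.MathematicalPhysics.QuantumLattice.dWaveFormFactor L) φ‖ ^ 2 := by
  intro U δ _ hδ γ hγ hALO hCF hFO
  obtain ⟨L₂, hALO⟩ := hALO
  obtain ⟨c, hc, L₁, hFO⟩ := hFO
  obtain ⟨L₃, hCF⟩ := hCF (1 / 4) (by norm_num)
  obtain ⟨C, hC⟩ := stub_pairTransferRung U (δ / 2) (by linarith [hδ.1])
  obtain ⟨L₄, hL₄⟩ := Filter.tendsto_atTop_atTop.1 hγ (max (4 * C / c) 1)
  refine ⟨c / 4, by positivity, max (max L₁ L₂) (max (max L₃ L₄) 4), ?_⟩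
  intro L _ hE hL
  simp only [max_le_iff] at hL
  obtain ⟨⟨hL₁, hL₂⟩, ⟨hL₃, hL₄'⟩, h4⟩ := hL
  -- specialise the three inputs and the scale at the side `L`
  obtain ⟨g, hg, hg1, hgc⟩ := hFO L hE hL₁
  have hD := hCF L hE hL₃
  have hGL : max (4 * C / c) 1 ≤ γ L * (L : ℝ) ^ 2 := hL₄ L hL₄'
  have hAg := hALO L hE hL₂ g hg
  dsimp only at hD hAg
  -- the filling `N_L = 2n`, `n = ⌊(1-δ)L²/2⌋`, and the bulk-window bounds of the rung
  set n : ℕ := ⌊(1 - δ) * (L : ℝ) ^ 2 / 2⌋₊ with hn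
  have hL4 : (4 : ℝ) ≤ L := by exact_mod_cast h4
  have hL16 : (16 : ℝ) ≤ (L : ℝ) ^ 2 := by nlinarith
  have hfl : (1 - δ) * (L : ℝ) ^ 2 / 2 < n + 1 := by rw [hn]; exact Nat.lt_floor_add_one _
  have hfu : (n : ℝ) ≤ (1 - δ) * (L : ℝ) ^ 2 / 2 :=
    hn ▸ Nat.floor_le (div_nonneg (mul_nonneg (by linarith [hδ.2]) (sq_nonneg _)) (by norm_num))
  have hp1 : 1 / 4 * (L : ℝ) ^ 2 ≤ (1 - 3 * δ / 2) * (L : ℝ) ^ 2 :=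
    mul_le_mul_of_nonneg_right (by linarith [hδ.2]) (sq_nonneg _)
  have hp2 : 0 ≤ δ / 2 * (L : ℝ) ^ 2 := mul_nonneg (by linarith [hδ.1]) (sq_nonneg _)
  have hn1 : 1 ≤ n := Nat.one_le_cast.1 (show (1 : ℝ) ≤ n by linarith)
  have hN2 : 2 * n - 2 + 2 = 2 * n := by omega
  have hN4 : 2 * n - 2 + 4 = 2 * n + 2 := by omega
  have hcast : ((2 * n - 2 : ℕ) : ℝ) = 2 * (n : ℝ) - 2 := by
    rw [Nat.cast_sub (by omega), Nat.cast_mul]; norm_num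
  have hlow : δ / 2 * (L : ℝ) ^ 2 ≤ ((2 * n - 2 : ℕ) : ℝ) := by rw [hcast]; linarith
  have hup : ((2 * n - 2 : ℕ) : ℝ) + 4 ≤ (2 - δ / 2) * (L : ℝ) ^ 2 := by rw [hcast]; linarith
  -- the scale: `γ_L > 0` and `4C ≤ γ_L L² c`
  have hγ0 : 0 < γ L := by
    by_contra hneg
    nlinarith [le_trans (le_max_right _ _) hGL, not_lt.1 hneg, sq_nonneg (L : ℝ)]
  have hG : 4 * C ≤ γ L * (L : ℝ) ^ 2 * c := (div_le_iff₀ hc).1 (le_trans (le_max_left _ _) hGL)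
  -- the Hamiltonian: Hermitian, conserving `N` and `S^z`, hence leaving the sector invariant
  have hHc := hamiltonian_isHermitian_and_commute_holds (fermionTorusGraph 2 L) 1 U
  have hHerm : (hubbardTorus 2 L 1 U).IsHermitian :=
    LiebThm1.hamiltonian_isHermitian (fermionTorusGraph 2 L) 1 U
  have hinv : ∀ v ∈ szSector (2 * n - 2) 0,
      hubbardTorus 2 L 1 U *ᵥ v ∈ szSector (2 * n - 2) (0 : ℝ) :=
    fun v hv => mulVec_mem_szSector_of_commute hHc.2.1 hHc.2.2 hv
  -- (1) the rung at `m = N_L - 2`, for `Δ = pairField dWaveFormFactor L`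
  set Δ : Matrix (Finset (Orb (FermionTorus 2 L))) (Finset (Orb (FermionTorus 2 L))) ℂ :=
    pairField dWaveFormFactor L with hΔ
  have hgN : IsGroundStateInSector (hubbardTorus 2 L 1 U) (2 * n - 2 + 2) 0 g := by
    rw [hN2]; exact hg
  obtain ⟨h1, h2, h3, -, -, -⟩ := hC L (2 * n - 2) g hlow hup hgN hg1
  rw [hN4] at h2
  rw [hN2, hN4] at h3
  simp only [expect, ← hΔ] at h3
  -- Gram identities `⟨g, ΔᴴΔ g⟩ = ‖Δg‖²`, `⟨g, ΔΔᴴ g⟩ = ‖Δᴴg‖²`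
  have hSu : star (Δ *ᵥ g) ⬝ᵥ (Δ *ᵥ g) = star g ⬝ᵥ (Δᴴ * Δ) *ᵥ g :=
    Literature.MathematicalPhysics.QuantumLattice.star_mulVec_dotProduct_mulVec _ _ g
  have hSp : star (Δᴴ *ᵥ g) ⬝ᵥ (Δᴴ *ᵥ g) = star g ⬝ᵥ (Δ * Δᴴ) *ᵥ g := by
    rw [Literature.MathematicalPhysics.QuantumLattice.star_mulVec_dotProduct_mulVec,
      conjTranspose_conjTranspose]
  rw [← hSu, ← hSp] at h3
  -- the `N_L + 2` summand of the rung is nonnegative (sector variational principle)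
  have hvar := rayleigh_sub_minEnergyOn_mul_nonneg hHerm (szSector (2 * n + 2) 0) h2
  -- (ii) charging floor at `ε = 1/4`
  have hM : max 0 (2 * (hubbardTorus 2 L 1 U).minEnergyOn (szSector (2 * n) 0) -
        (hubbardTorus 2 L 1 U).minEnergyOn (szSector (2 * n - 2) 0) -
        (hubbardTorus 2 L 1 U).minEnergyOn (szSector (2 * n + 2) 0)) * (star (Δ *ᵥ g) ⬝ᵥ (Δ *ᵥ g)).re ≤
      γ L / 4 * (star (Δ *ᵥ g) ⬝ᵥ (Δ *ᵥ g)).re :=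
    mul_le_mul_of_nonneg_right (max_le (by linarith) (by linarith))
      (re_star_dotProduct_self_nonneg _)
  -- (2) spectral Markov with the window weight in the sector `(N_L - 2, 0)`
  obtain ⟨u₀, hu₀K, hHu₀, hu₀u, hmk⟩ := spectralMarkov_of_window_weight hHerm
    (szSector (2 * n - 2) 0) hinv h1 (γ L) (1 / 4) hγ0.le hAg
  -- (3) the endgame: `‖u₀‖² ≥ (c/4) L⁴`
  have hX : c / 4 * ((L : ℝ) ^ 2) ^ 2 ≤ (star u₀ ⬝ᵥ u₀).re :=
    bridge_real_endgame_approx hγ0 (sq_nonneg _) hmk h3 hvar hM (by rw [← pow_mul]; exact hgc) hG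
  rw [← pow_mul] at hX; norm_num at hX
  -- normalise `u₀`
  have hu₀ne : u₀ ≠ 0 := by
    intro h0
    rw [h0, dotProduct_zero, Complex.zero_re] at hX
    have : (0 : ℝ) < c / 4 * (L : ℝ) ^ 4 := by positivity
    linarith
  obtain ⟨a, -, haa, ha1⟩ := exists_normalize hu₀ne
  have hχne : (a : ℂ) • u₀ ≠ 0 := by
    intro h0
    rw [h0, star_zero, zero_dotProduct] at ha1
    exact zero_ne_one ha1
  have hHχ : hubbardTorus 2 L 1 U *ᵥ ((a : ℂ) • u₀) =
      (((hubbardTorus 2 L 1 U).minEnergyOn (szSector (2 * n - 2) 0) : ℝ) : ℂ) • ((a : ℂ) • u₀) := by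
    rw [mulVec_smul, hHu₀, smul_comm]
  have hXc : star u₀ ⬝ᵥ u₀ = (((star u₀ ⬝ᵥ u₀).re : ℝ) : ℂ) :=
    Complex.ext (by simp) (by simp [im_star_dotProduct_self])
  have hsq : (a * (star u₀ ⬝ᵥ u₀).re) ^ 2 = (star u₀ ⬝ᵥ u₀).re := by
    calc (a * (star u₀ ⬝ᵥ u₀).re) ^ 2 = a * a * (star u₀ ⬝ᵥ u₀).re * (star u₀ ⬝ᵥ u₀).re := by ring
      _ = (star u₀ ⬝ᵥ u₀).re := by rw [haa, one_mul]
  have hbound : c / 4 * (L : ℝ) ^ 4 ≤ ‖star ((a : ℂ) • u₀) ⬝ᵥ (Δ *ᵥ g)‖ ^ 2 := by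
    rw [star_smul, smul_dotProduct, hu₀u, hXc, Complex.star_def, Complex.conj_ofReal, smul_eq_mul,
      ← Complex.ofReal_mul, Complex.norm_real, Real.norm_eq_abs, sq_abs, hsq]
    exact hX
  exact ⟨g, (a : ℂ) • u₀, hg, hg1, ⟨Submodule.smul_mem _ _ hu₀K, hχne, hHχ⟩, ha1, hbound⟩

end Summit.HubbardSuperconductivity.HubbardSuperconductivity.Theorems.JosephsonMirror
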